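import Literature.AlgebraicGeometry.ShimuraVarieties.UnitaryBallCauchyRiemannDictionary
import Literature.Geometry.ComplexHyperbolic.UnitBallIsotropyBlock
import HarnessLib

/-!
# The canonical automorphy factor `J(g, z) = (Λ(g,z), μ(g,z)) ∈ GL₂(ℂ) × GL₁(ℂ)` of `U(2,1)` on the ball

Topic `AlgebraicGeometry/ShimuraVarieties`; namespace `Literature.AlgebraicGeometry.ShimuraVarieties.BallForms` (the
grouping namespace of the tree's ball-model automorphic forms). Definitions with bodies and kernel-checked theorems
over the tree (`UnitBallU21`, `UnitBallJacobian`, `UnitBallIsotropyBlock`, `UnitaryBallCauchyRiemann*`) and Mathlib;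
no named fact.

For `g = [[A, B], [C, d]] ∈ U(2,1)` (`A` the upper-left `2 × 2` block, `C` the lower-left row, `d = g₂₂`) acting on
`𝔹² ⊂ ℂ²` by `g·z = (Az + B)(Cz + d)⁻¹` (the tree's `BallModel` action), the **canonical automorphy factor** in the
sense of Satake / Baily–Borel is the `K_ℂ = GL₂(ℂ) × GL₁(ℂ)`-component of `g · exp z` in the Harish-Chandra
decomposition `P₊ K_ℂ P₋` of (an open part of) `GL₃(ℂ)`:

  `J(g, z) = (g · exp z)₀ = (Λ(g, z), μ(g, z))`,  `Λ(g, z) = A − (g·z) C ∈ GL₂(ℂ)`,  `μ(g, z) = C z + d ∈ ℂˣ`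

(Lee 2004, (6.26)–(6.27) following Satake, *Algebraic structures of symmetric domains* II §5; Lemma 6.7 there is the
same computation for `Sp(V, β)`; in rank one `μ` is Borel's `μ_D(g, w) = b̄ w + ā`, Borel 1997 4.1 (6)).

* §1 `mu g z = μ(g,z)` (`= W3 g z 2`, the denominator of the action) and `lam g z = Λ(g,z)`; **`Λ = μ · Jac`**
  (`lam_eq_mu_smul_Jac`): the holomorphic tangent action `Jac g z` of the tree is `Λ μ⁻¹`.
* §2 the cocycle identities `μ(gh, z) = μ(g, h z) μ(h, z)`, `Λ(gh, z) = Λ(g, h z) Λ(h, z)` (`mu_mul`, `lam_mul`, from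
  the tree's chain rule `Jac_mul`), **`det Λ(g,z) = det g / μ(g,z)`** (`det_lam`; hence the tree's
  `det Jac = det g / μ³` and `canonicalFactor = det Λ / μ²`), inverses.
* §3 values at the base point `x₀ = 0`: **`J(k, x₀) = k`** for `k = diag(A, d) ∈ K = U(2) × U(1)` (`lam_blockU_x₀`,
  `mu_blockU_x₀`; Borel 1997 4.2 (3) `μ_D(k, 0) = χ_{−1}(k)` in rank one), and the **Harish-Chandra decomposition**
  `g · (1 + E₊(z)) = (1 + E₊(g·z)) · diag(Λ(g,z), μ(g,z)) · (1 + E₊(μ⁻¹C))ᵀ` (`mat_mul_one_add_pPlus`, with `E₊ = pPlus` the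
  upper-right block of the tree's `𝔭 = 𝔭₊ ⊕ 𝔭₋` split) certifying that `(Λ, μ)` is `(g exp z)₀`.
* §4 holomorphy in `z`: `z ↦ μ(g, z)` and the entries of `z ↦ Λ(g, z)` are holomorphic on the ball
  (`mu_mem_holomorphic`, `lam_apply_mem_holomorphic`; ambient rational formulas).
* §5 first-order triviality along `exp 𝔭`: `b ↦ μ(exp X_b, x₀)` and the entries of `b ↦ Λ(exp X_b, x₀)` have ZERO
  derivative at `b = 0` (`hasFDerivAt_mu_expP`, `hasFDerivAt_lam_expP_apply`; Borel 1997 Lemma 4.4 in rank one) — the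
  input `differentiableAt_expP` of the Cauchy–Riemann dictionary `UnitaryBallCauchyRiemannDictionary` for the factors
  `τ(J(g, z))` of the `K`-types `τ` (sequel file `UnitaryBallKTypeFactors`).

Conventions. `U(2,1) = {g | gᴴ J g = J}`, `J = diag(1,1,−1)`, `x₀ = 0`, `K = Stab(x₀) = {diag(A, d)}` (the tree's
`blockU : K21 →* U21`, `stabilizerEquivK21`); `𝔭₊` = upper-right block, `𝔭₋` = lower-left block (orientation pin of
`UnitaryBallPSplit`). `Λ` and `μ` are LEFT cocycles (`Λ(gh,z) = Λ(g,hz)Λ(h,z)`), like `Jac`; the tree's pull-back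
cocycles (`IsHolMatrixFactor`: `M(gh,z) = M(h,z)M(g,hz)`) are obtained from them by `M = τ(J)⁻¹` (sequel file).

NOT HERE: the `K`-type factors `τ(J(g,z))` and their dictionary (sequel `UnitaryBallKTypeFactors`); the canonical
kernel function `κ(z, z') = J(exp(−z̄'), z)⁻¹` (Lee 2004 (6.29)); higher rank `U(n,1)` / `U(p,q)`.

## References

* M. H. Lee, *Mixed Automorphic Forms, Torus Bundles, and Jacobi Forms*, LNM 1845 (2004), §6.2: (6.26)–(6.27)
  (canonical automorphy factor `J(g,z) = (g exp z)₀ ∈ K_ℂ`), Lemma 6.7 (the computation for `Sp`: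
  `J^S(g, Z) = diag(ᵗ(CZ+D)⁻¹, CZ+D)`) [Lee2004] — following I. Satake, *Algebraic Structures of Symmetric Domains*
  (1980), II §5.
* A. Borel, *Automorphic forms on `SL₂(ℝ)`* (1997), 3.3 (6)–(7) (automorphy factors, cocycle identity), 4.1 (5)–(6)
  (`dg/dw = μ_D(g,w)⁻²`, `μ_D(g, w) = b̄w + ā`), 4.2 (3) (`μ_D(k, 0) = χ_{−1}(k)`), Lemma 4.4
  (`μ_D(g₊ g₀ g₋, 0) = χ_{−1}(g₀)`) [Borel1997].
* H. Jacobowitz, *An Introduction to CR Structures* (1990), Ch. 2 §1 (the action; `Stab(0) = U(1) × U(2)`) [Jacobowitz1990].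

## Provenance

Written for the COR-CM cell `pub-hodgecm2` (Hodge ladder stage 2), literature fan-out row D9 (b) (gap G1 of the D9
audit: the `K`-type factors). Kernel only; nothing here is a claim of the manuscripts adjudicated by that cell.
-/

set_option autoImplicit false

noncomputable section

open scoped Matrix Matrix.Norms.Operator Topology ComplexConjugate
open MulAction
open Literature.Geometry.ComplexHyperbolic
open Literature.Geometry.ComplexHyperbolic.BallModel
open Literature.NumberTheory.Automorphic Literature.NumberTheory.Automorphic.AutomorphyFactor
open Literature.NumberTheory.Automorphic.U21 (K21 matA sclD)

namespace Literature.AlgebraicGeometry.ShimuraVarieties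

namespace BallForms

/-! ### 1. The two components `μ(g,z) = Cz + d` and `Λ(g,z) = A − (g·z)C` -/

section Defs

/-- The **scalar canonical automorphy factor** `μ(g, z) = C z + d = (g·(z,1))₂` of `g = [[A, B], [C, d]] ∈ U(2,1)`
at `z ∈ 𝔹²` (the `GL₁(ℂ)`-component of the canonical automorphy factor; in rank one this is Borel's
`μ_D(g, w) = b̄ w + ā`). [cite: Borel1997, 4.1 (6)] -/
def mu (g : U21) (z : Ball) : ℂ := W3 g z 2

/-- `μ(g, z) = (g·(z,1))₂`, the last homogeneous coordinate of `g·(z,1)`. [cite: Borel1997, 3.3 (6)] -/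
theorem mu_def (g : U21) (z : Ball) : mu g z = W3 g z 2 := rfl

/-- `μ(g, z) = g₂₀ z₀ + g₂₁ z₁ + g₂₂` ("`cz + d`"). [cite: Borel1997, 3.3 (6)] -/
theorem mu_eq (g : U21) (z : Ball) : mu g z = mat g 2 0 * z.1 0 + mat g 2 1 * z.1 1 + mat g 2 2 :=
  W3_apply g z 2

/-- `μ(g, z) ≠ 0` on the ball: the automorphy factor takes values in `ℂˣ`. [cite: Borel1997, 3.3 (6)–(7)] -/
theorem mu_ne_zero (g : U21) (z : Ball) : mu g z ≠ 0 := W3_2_ne_zero g z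

/-- The **matrix canonical automorphy factor** `Λ(g, z) = A − (g·z) C ∈ M₂(ℂ)` of `g = [[A, B], [C, d]] ∈ U(2,1)` at
`z ∈ 𝔹²` (the `GL₂(ℂ)`-component of the canonical automorphy factor `J(g,z) = (g · exp z)₀`, cf.
`mat_mul_one_add_pPlus`). [cite: Lee2004, (6.27) and Lemma 6.7] -/
def lam (g : U21) (z : Ball) : Matrix (Fin 2) (Fin 2) ℂ :=
  Matrix.of fun i j => mat g (Fin.castSucc i) (Fin.castSucc j) - (g • z).1 i * mat g 2 (Fin.castSucc j)

/-- Entries of `Λ(g, z) = A − (g·z) C`. [cite: Lee2004, (6.27) and Lemma 6.7] -/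
theorem lam_apply (g : U21) (z : Ball) (i j : Fin 2) :
    lam g z i j = mat g (Fin.castSucc i) (Fin.castSucc j) - (g • z).1 i * mat g 2 (Fin.castSucc j) := rfl

/-- **`Λ(g, z) = μ(g, z) · Jac g z`**: the Jacobian of `z ↦ g·z` is `Λ μ⁻¹`. [cite: Lee2004, Lemma 6.7] -/
theorem lam_eq_mu_smul_Jac (g : U21) (z : Ball) : lam g z = mu g z • Jac g z := by
  have h2 := W3_2_ne_zero g z
  ext i j
  rw [lam_apply, Matrix.smul_apply, smul_eq_mul, smul_val, Jac, Matrix.of_apply, mu_def]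
  field_simp

/-- `Jac g z = μ(g,z)⁻¹ · Λ(g,z)`. [cite: Lee2004, Lemma 6.7] -/
theorem Jac_eq_mu_inv_smul_lam (g : U21) (z : Ball) : Jac g z = (mu g z)⁻¹ • lam g z := by
  rw [lam_eq_mu_smul_Jac, smul_smul, inv_mul_cancel₀ (mu_ne_zero g z), one_smul]

end Defs

/-! ### 2. Cocycle identities, determinant, inverses -/

section Cocycle

/-- `μ(1, z) = 1` (cocycle identity at `g = 1`). [cite: Borel1997, 3.3 (7)] -/
@[simp] theorem mu_one (z : Ball) : mu 1 z = 1 := by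
  rw [mu_def, W3_one]; rfl

/-- The cocycle identity `μ(gh, z) = μ(g, h·z) μ(h, z)`. [cite: Borel1997, 3.3 (7)] -/
theorem mu_mul (g h : U21) (z : Ball) : mu (g * h) z = mu g (h • z) * mu h z := by
  rw [mu_def, mu_def, mu_def, W3_smul, W3_mul, mul_comm ((W3 h z 2)⁻¹) _, mul_assoc,
    inv_mul_cancel₀ (W3_2_ne_zero h z), mul_one]

/-- `Λ(1, z) = 1` (cocycle identity at `g = 1`). [cite: Borel1997, 3.3 (7)] -/
@[simp] theorem lam_one (z : Ball) : lam 1 z = 1 := by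
  rw [lam_eq_mu_smul_Jac, mu_one, Jac_one, one_smul]

/-- The cocycle identity `Λ(gh, z) = Λ(g, h·z) Λ(h, z)` (chain rule `Jac_mul` times `mu_mul`). [cite: Borel1997, 3.3 (7)] -/
theorem lam_mul (g h : U21) (z : Ball) : lam (g * h) z = lam g (h • z) * lam h z := by
  rw [lam_eq_mu_smul_Jac, lam_eq_mu_smul_Jac, lam_eq_mu_smul_Jac, mu_mul, Jac_mul, Matrix.smul_mul,
    Matrix.mul_smul, smul_smul]

/-- **`det Λ(g, z) = det g / μ(g, z)`** (so `det Jac = det g / μ³`, the tree's `det_Jac`; rank one: `dg/dw = μ_D(g,w)⁻²`).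
[cite: Borel1997, 4.1 (5)–(6)] -/
theorem det_lam (g : U21) (z : Ball) : (lam g z).det = (mat g).det / mu g z := by
  have h2 := mu_ne_zero g z
  rw [lam_eq_mu_smul_Jac, Matrix.det_smul, det_Jac, Fintype.card_fin, ← mu_def]
  field_simp

/-- `det Λ(g, z) ≠ 0`: `Λ(g, z) ∈ GL₂(ℂ)`. [cite: Lee2004, (6.27)] -/
theorem det_lam_ne_zero (g : U21) (z : Ball) : (lam g z).det ≠ 0 := by
  rw [det_lam]; exact div_ne_zero (det_mat_ne_zero g) (mu_ne_zero g z)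

/-- `det Λ(g, z)` is a unit: `Λ(g, z) ∈ GL₂(ℂ)`. [cite: Lee2004, (6.27)] -/
theorem isUnit_det_lam (g : U21) (z : Ball) : IsUnit (lam g z).det :=
  isUnit_iff_ne_zero.2 (det_lam_ne_zero g z)

/-- `Λ(g⁻¹, g·z) Λ(g, z) = 1` (cocycle identity at `g⁻¹ g = 1`). [cite: Borel1997, 3.3 (7)] -/
theorem lam_inv_mul (g : U21) (z : Ball) : lam g⁻¹ (g • z) * lam g z = 1 := by
  rw [← lam_mul, inv_mul_cancel, lam_one]

/-- `Λ(g, z) Λ(g⁻¹, g·z) = 1`. [cite: Borel1997, 3.3 (7)] -/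
theorem lam_mul_inv (g : U21) (z : Ball) : lam g z * lam g⁻¹ (g • z) = 1 :=
  mul_eq_one_comm.1 (lam_inv_mul g z)

/-- `Λ(g, z)⁻¹ = Λ(g⁻¹, g·z)`. [cite: Borel1997, 3.3 (7)] -/
theorem lam_inv_eq (g : U21) (z : Ball) : (lam g z)⁻¹ = lam g⁻¹ (g • z) :=
  Matrix.inv_eq_right_inv (lam_mul_inv g z)

/-- `μ(g⁻¹, g·z) μ(g, z) = 1` (cocycle identity at `g⁻¹ g = 1`). [cite: Borel1997, 3.3 (7)] -/
theorem mu_inv_mul (g : U21) (z : Ball) : mu g⁻¹ (g • z) * mu g z = 1 := by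
  rw [← mu_mul, inv_mul_cancel, mu_one]

/-- `μ(g, z)⁻¹ = μ(g⁻¹, g·z)`. [cite: Borel1997, 3.3 (7)] -/
theorem mu_inv_eq (g : U21) (z : Ball) : (mu g z)⁻¹ = mu g⁻¹ (g • z) :=
  inv_eq_of_mul_eq_one_left (mu_inv_mul g z)

/-- The tree's canonical bundle factor `det Jac g z` is `det Λ(g,z) / μ(g,z)²` (rank one: `dg/dw = μ_D(g,w)⁻²`).
[cite: Borel1997, 4.1 (5)–(6)] -/
theorem canonicalFactor_eq_det_lam_div (g : U21) (z : Ball) :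
    canonicalFactor g z = (lam g z).det / mu g z ^ 2 := by
  have h2 := mu_ne_zero g z
  rw [canonicalFactor, det_lam, det_Jac, ← mu_def]
  field_simp

/-- The tree's cotangent factor `(Jac g z)ᵀ` is `μ(g,z)⁻¹ · Λ(g,z)ᵀ`. [cite: Lee2004, Lemma 6.7] -/
theorem transpose_Jac_eq (g : U21) (z : Ball) : (Jac g z)ᵀ = (mu g z)⁻¹ • (lam g z)ᵀ := by
  rw [Jac_eq_mu_inv_smul_lam, Matrix.transpose_smul]

end Cocycle

/-! ### 3. Values at the base point: `J(k, x₀) = k` on `K = U(2) × U(1)`; the Harish-Chandra decomposition -/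

section BasePoint

/-- `μ(g, x₀) = g₂₂` (value at the base point). [cite: Borel1997, 4.2 (3)] -/
theorem mu_x₀ (g : U21) : mu g x₀ = mat g 2 2 := W3_x₀ g 2

/-- `Λ(g, x₀)ᵢⱼ = gᵢⱼ − gᵢ₂ g₂ⱼ / g₂₂` (value at the base point). [cite: Borel1997, 4.2 (3)] -/
theorem lam_x₀_apply (g : U21) (i j : Fin 2) :
    lam g x₀ i j = mat g (Fin.castSucc i) (Fin.castSucc j) -
      mat g (Fin.castSucc i) 2 / mat g 2 2 * mat g 2 (Fin.castSucc j) := by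
  rw [lam_apply, smul_val, W3_x₀, W3_x₀]

/-- **`μ(k, x₀) = d` for `k = diag(A, d) ∈ K`** (Borel's `μ_D(k, 0) = χ_{-1}(k)`). [cite: Borel1997, 4.2 (3)] -/
theorem mu_blockU_x₀ (k : K21) : mu (blockU k) x₀ = sclD k := by
  rw [mu_x₀, mat_blockU]; rfl

/-- **`Λ(k, x₀) = A` for `k = diag(A, d) ∈ K`**: on `K × {x₀}` the canonical automorphy factor is the
inclusion `K ↪ K_ℂ`. [cite: Borel1997, 4.2 (3)] -/
theorem lam_blockU_x₀ (k : K21) : lam (blockU k) x₀ = matA k := by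
  ext i j
  rw [lam_apply, blockU_smul_x₀, mat_blockU]
  fin_cases i <;> fin_cases j <;> simp [bmat, x₀]

/-- For `g` in the stabiliser of `x₀`, `Λ(g, x₀)` is the upper-left block of `g`. [cite: Borel1997, 4.2 (3)] -/
theorem lam_x₀_of_smul_x₀ {g : U21} (hg : g • x₀ = x₀) : lam g x₀ = ulBlock g := by
  ext i j
  rw [lam_apply, hg]
  simp [ulBlock, x₀]

/-- **Harish-Chandra decomposition `g · exp z = exp(g·z) · diag(Λ(g,z), μ(g,z)) · p₋`** with `exp z = 1 + E₊(z) ∈ P₊`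
(`E₊ = pPlus`, the upper-right block) and `p₋ = (1 + E₊(μ⁻¹ C))ᵀ ∈ P₋` (unipotent, lower-left block): the pair
`(Λ(g,z), μ(g,z))` IS the `K_ℂ = GL₂(ℂ) × GL₁(ℂ)`-component `(g · exp z)₀` of `g · exp z ∈ P₊ K_ℂ P₋`, i.e. Satake's
canonical automorphy factor `J(g, z)`. [cite: Lee2004, (6.26)–(6.27) and Lemma 6.7] -/
theorem mat_mul_one_add_pPlus (g : U21) (z : Ball) :
    mat g * (1 + pPlus z.1) =
      (1 + pPlus (g • z).1) * bmat (lam g z) (mu g z) *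
        (1 + pPlus ((mu g z)⁻¹ • fun j : Fin 2 => mat g 2 (Fin.castSucc j)))ᵀ := by
  have h2 : mu g z ≠ 0 := mu_ne_zero g z
  have hz : ∀ i : Fin 2, (g • z).1 i = W3 g z (Fin.castSucc i) / mu g z := fun i => smul_val g z i
  have hz0 := hz 0
  have hz1 := hz 1
  simp only [Fin.castSucc_zero, Fin.castSucc_one] at hz0 hz1
  have hW' : ∀ k : Fin 3, mat g k 0 * z.1 0 + mat g k 1 * z.1 1 + mat g k 2 = W3 g z k :=
    fun k => (W3_apply g z k).symm
  have hmu' : W3 g z 2 = mu g z := rfl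
  ext i j
  fin_cases i <;> fin_cases j <;>
    simp [Matrix.mul_apply, Fin.sum_univ_three, pPlus, bmat, lam_apply, hz0, hz1, hW', Matrix.one_apply, hmu']
  all_goals (try field_simp)
  all_goals (try ring)

end BasePoint

/-! ### 4. Holomorphy in `z` -/

section Holomorphy

/-- Ambient version of `μ`: `y ↦ (g·(y,1))₂` on all of `ℂ²` (plumbing). [folklore] -/
private def muAmb (g : U21) (y : Fin 2 → ℂ) : ℂ := homogAmb g y 2

/-- Ambient version of `Λ`: `y ↦ A − (g·y) C` on all of `ℂ²`, `g·y = actVec g y` (plumbing). [folklore] -/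
private def lamAmb (g : U21) (y : Fin 2 → ℂ) : Matrix (Fin 2) (Fin 2) ℂ :=
  Matrix.of fun i j => mat g (Fin.castSucc i) (Fin.castSucc j) - actVec g y i * mat g 2 (Fin.castSucc j)

/-- On the ball `lamAmb g z = Λ(g, z)`. [folklore] -/
private theorem lamAmb_coe (g : U21) (z : Ball) : lamAmb g z.1 = lam g z := by
  ext i j
  rw [lamAmb, Matrix.of_apply, actVec_eq, lam_apply]

/-- The entries of `lamAmb g` are `ℂ`-differentiable at points of the ball. [folklore] -/
private theorem differentiableAt_lamAmb_apply (g : U21) (i j : Fin 2) {y : Fin 2 → ℂ} (hy : y ∈ ballSet) :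
    DifferentiableAt ℂ (fun y => lamAmb g y i j) y := by
  have h : DifferentiableAt ℂ (fun y => actVec g y i) y :=
    ((ContinuousLinearMap.proj (R := ℂ) (φ := fun _ : Fin 2 => ℂ) i).differentiableAt).comp y
      (differentiableAt_actVec g hy)
  simp only [lamAmb, Matrix.of_apply]
  exact (differentiableAt_const _).sub (h.mul_const _)

/-- A function on the ball which is the restriction of an ambient function `ℂ`-differentiable at the points of
the ball is holomorphic (plumbing for `holomorphic`). [folklore] -/
private theorem mem_holomorphic_of_ambient {W : Type*} [NormedAddCommGroup W] [NormedSpace ℂ W] (φ : Ball → W)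
    (Φ : (Fin 2 → ℂ) → W) (h : ∀ z : Ball, φ z = Φ z.1) (hΦ : ∀ y ∈ ballSet, DifferentiableAt ℂ Φ y) :
    φ ∈ holomorphic W := by
  rw [mem_holomorphic_iff]
  intro y hy
  have heq : extend W φ =ᶠ[𝓝 y] Φ := by
    filter_upwards [isOpen_ballSet.mem_nhds hy] with w hw
    rw [← h ⟨w, hw⟩, ← extend_apply_coe φ ⟨w, hw⟩]
  exact ((heq.differentiableAt_iff).2 (hΦ y hy)).differentiableWithinAt

/-- **`z ↦ μ(g, z)` is holomorphic on the ball** (it is affine in `z`). [cite: Borel1997, 3.3 (6)] -/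
theorem mu_mem_holomorphic (g : U21) : (fun z : Ball => mu g z) ∈ holomorphic ℂ :=
  mem_holomorphic_of_ambient _ (muAmb g) (fun _ => rfl) fun y _ => differentiableAt_homogAmb g 2 y

/-- **The entries of `z ↦ Λ(g, z)` are holomorphic on the ball** (rational in `z`, denominator `μ(g,z) ≠ 0`): the
canonical automorphy factor is holomorphic in `z`. [cite: Lee2004, (6.27)–(6.28)] -/
theorem lam_apply_mem_holomorphic (g : U21) (i j : Fin 2) : (fun z : Ball => lam g z i j) ∈ holomorphic ℂ :=
  mem_holomorphic_of_ambient _ (fun y => lamAmb g y i j) (fun z => by rw [lamAmb_coe])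
    fun _ hy => differentiableAt_lamAmb_apply g i j hy

end Holomorphy

/-! ### 5. First-order triviality along `exp 𝔭` at the base point -/

section ExpP

/-- Entries of `b ↦ exp X_b` have derivative `b ↦ (X_b)_{kl}` at `b = 0`. [folklore] -/
private theorem hasFDerivAt_exp_pMat_apply (k l : Fin 3) :
    HasFDerivAt (fun b : Fin 2 → ℂ => NormedSpace.exp (pMat b) k l)
      (((entryL (m := Fin 3) (n := Fin 3) k l).restrictScalars ℝ).comp pMatL) 0 :=
  (((entryL (m := Fin 3) (n := Fin 3) k l).restrictScalars ℝ).hasFDerivAt).comp (0 : Fin 2 → ℂ)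
    hasFDerivAt_exp_pMat

/-- **`b ↦ μ(exp X_b, x₀) = (exp X_b)₂₂` has ZERO derivative at `b = 0`** (`(X_b)₂₂ = 0`: the factor is trivial to
first order along `exp 𝔭`). [cite: Borel1997, Lemma 4.4] -/
theorem hasFDerivAt_mu_expP : HasFDerivAt (fun b : Fin 2 → ℂ => mu (expP b) x₀) (0 : (Fin 2 → ℂ) →L[ℂ] ℂ) 0 := by
  have hfun : (fun b : Fin 2 → ℂ => mu (expP b) x₀) = fun b => NormedSpace.exp (pMat b) 2 2 := by
    funext b; rw [mu_x₀, mat_expP]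
  rw [hfun]
  refine hasFDerivAt_of_restrictScalars ℝ (hasFDerivAt_exp_pMat_apply 2 2) ?_
  ext b
  simp

/-- `b ↦ μ(exp X_b, x₀)` is `ℂ`-differentiable at `0` (first-order triviality of the factor along `exp 𝔭`).
[cite: Borel1997, Lemma 4.4] -/
theorem differentiableAt_mu_expP : DifferentiableAt ℂ (fun b : Fin 2 → ℂ => mu (expP b) x₀) 0 :=
  hasFDerivAt_mu_expP.differentiableAt

/-- **The entries of `b ↦ Λ(exp X_b, x₀)` have ZERO derivative at `b = 0`** (`Λ = μ · Jac` and both factors are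
first-order trivial, `hasFDerivAt_qAt0_exp`). [cite: Borel1997, Lemma 4.4] -/
theorem hasFDerivAt_lam_expP_apply (i j : Fin 2) :
    HasFDerivAt (fun b : Fin 2 → ℂ => lam (expP b) x₀ i j) (0 : (Fin 2 → ℂ) →L[ℂ] ℂ) 0 := by
  have hfun : (fun b : Fin 2 → ℂ => lam (expP b) x₀ i j) =
      fun b => mu (expP b) x₀ * qAt0 i j (NormedSpace.exp (pMat b)) := by
    funext b
    rw [lam_eq_mu_smul_Jac, Matrix.smul_apply, smul_eq_mul, Jac_x₀_eq, JacAt0_apply, mat_expP]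
  rw [hfun]
  refine (hasFDerivAt_mu_expP.fun_mul (hasFDerivAt_qAt0_exp_complex i j)).congr_fderiv ?_
  ext v
  simp

/-- The entries of `b ↦ Λ(exp X_b, x₀)` are `ℂ`-differentiable at `0` (first-order triviality of the factor along
`exp 𝔭`). [cite: Borel1997, Lemma 4.4] -/
theorem differentiableAt_lam_expP_apply (i j : Fin 2) :
    DifferentiableAt ℂ (fun b : Fin 2 → ℂ => lam (expP b) x₀ i j) 0 :=
  (hasFDerivAt_lam_expP_apply i j).differentiableAt

end ExpP

end BallForms

end Literature.AlgebraicGeometry.ShimuraVarieties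

end
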